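import Mathlib
import HarnessLib
import Summits.AtomisticToContinuum.FouriersLaw.Theses.ParabolicBathMap
import Summits.AtomisticToContinuum.FouriersLaw.Theses.JunctionLocality
import Summits.AtomisticToContinuum.FouriersLaw.Theorems.OddSectorIrreversibilityBoundedResponseConvergesStubPositiveConductance

/-!
# Birth skeleton (BC3) for the crux `Recurrence` — line `birth`
# ("no ballistic floor + the resistance never drops by more than a contact constant")

Crux (FIXED, concluded below BY NAME):
`Summit.AtomisticToContinuum.FouriersLaw.Theses.ParabolicBathMap.Recurrence`
(stmt-AtomisticToContinuum-11923, route `ParabolicBathMap`, sub-problem `FouriersLaw`, rank 5):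
for `pinnedChain ω₂ lam β γ` (all `> 0`), under weak-NESS uniqueness, for every steady-state family
`μ`, every `T > 0` and every CONDUCTANCE sequence `G`
(`G N = lim_{δ→0, δ≠0} totalCurrent(μ N (T+δ/2) (T−δ/2)) / ((N−1) δ)` for `N ≥ 2`):
`G N → 0` — the semi-infinite pinned anharmonic chain is closed at DC (no ballistic channel).

## The line

`lim_N G_N = 0` is split along the only two ways a positive sequence can fail to tend to `0`:

* `stub_nonBallistic` (THE MAZUR CONTENT; verbatim the shared crux
  `Summit.AtomisticToContinuum.FouriersLaw.Theses.JunctionLocality.NonBallistic`,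
  stmt-AtomisticToContinuum-9127, in its response (`D`) form): the conductance is NOT BOUNDED AWAY
  FROM `0` — for every `ε > 0` there are arbitrarily long chains with `D_N ≤ ε (N − 1)`, i.e.
  `liminf_N G_N = 0`. Necessary for the conjunct; false exactly when a ballistic channel (hidden
  conserved charge overlapping the current) exists.
* `stub_resistanceQuasiMonotone` (THE JUNCTION CONTENT, new, one-sided series law): the
  bath-to-bath resistance `R_N := 1/G_N` is non-decreasing in the length UP TO A BOUNDED DEFECT:
  `∃ C, ∀ 2 ≤ N ≤ M, R_M ≥ R_N − C` (positivity of `G_N, G_M` as antecedents, so the statement does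
  not depend on the sign lemma). Extending a chain can lower its resistance by at most a contact
  constant — the weakest form of the route's "one more atom adds one resistance quantum"
  (`ResistanceQuantum` asserts the increments are eventually `≥ a > 0` GIVEN `G → 0`; here only
  `≥ −C` over any stretch, unconditionally). Strictly weaker than two-piece superadditivity
  `R_{N+M} ≥ R_N + R_M − C` + positivity (`JunctionLocality.SuperadditiveResistance`) for
  `M ≥ N + 2`.
* POSITIVITY `G_N > 0` (`N ≥ 2`) is NOT a stub: it is the LANDED theorem
  `Cruxes.BoundedResponseConverges.TwoScaleGluingLogRigidity.Stubs.positiveConductance_holds`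
  (= `FeketeSeriesLaw.PositiveConductance`, stmt-11750, `D`-form), moved to conductance form inside
  `Recurrence_of` by the `G ↦ D_N := (N−1) G_N` bridge (`response_of_conductance`; `D_0 = D_1 = 0`
  because chains with `N ≤ 1` sites have no bond). (By the same bridge the route's open support item
  `ParabolicBathMap.OhmicSign`, stmt-11924, is provable now — recorded in the line card, not done here.)
* `Recurrence_of` (kernel-checked composition, no sorry, ~60 lines of real analysis): given `ε > 0`
  put `K := 2/ε + |C|`; `stub_nonBallistic` (through the bridge) yields `N ≥ 2` with `G_N ≤ K⁻¹`,
  i.e. `R_N ≥ K`; `stub_resistanceQuasiMonotone` gives `R_M ≥ R_N − C ≥ 2/ε` for every `M ≥ N`, so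
  `0 < G_M ≤ ε/2 < ε` eventually: `G → 0`.

Honours the crux's "why it might fail" exactly: a hidden conserved charge / Drude weight kills
`stub_nonBallistic` (and with it `FouriersLaw`: `¬NonBallistic → ¬FouriersLaw` is recorded in
`Cruxes/NonBallistic/Disproof.lean`); a coherent (Fabry–Pérot-type) length resonance lowering the
resistance by an unbounded amount would kill `stub_resistanceQuasiMonotone` while leaving the crux
open. Harmonic member `lam = β = 0`: `stub_resistanceQuasiMonotone` holds (bounded resistance,
`HarmonicCalibration`), `stub_nonBallistic` fails — every proof of the line must use `lam, β > 0`
in the non-ballistic stub, as the barrier `HarmonicChainBallisticFlux` demands.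
Disproof.lean for this crux: none on file (2026-08-17). Dead lines: none.

## File map

* §1 `Sig.stub_<name> : Prop` — the two stub STATEMENTS (+ in-kernel identity of the second with
  the shared crux decl `JunctionLocality.NonBallistic`).
* §2 `theorem stub_<name> : <statement verbatim> := by sorry` — the registered stubs (the ONLY sorries).
* §3 sorry-free helpers: no bond for `N ≤ 1`; the conductance → response bridge.
* §4 `Recurrence_of : Sig.stub_resistanceQuasiMonotone → Sig.stub_nonBallistic → Recurrence` — the
  composition (no sorry; the UNIQUE declaration concluding the crux), and an `example` instantiating
  it through the sorried stubs.
-/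

namespace Summit.AtomisticToContinuum.FouriersLaw.Cruxes.Recurrence.Birth

open Filter Topology
open Literature.MathematicalPhysics.KineticTheory.HeatConduction

/-! ## §1 The stub statements -/

/-- JUNCTION CONTENT (one-sided series law): along every conductance sequence of the crux, the
resistance `1/G_N` never drops by more than a constant when the chain is extended:
`∃ C, ∀ 2 ≤ N ≤ M, 0 < G N → 0 < G M → (G N)⁻¹ - C ≤ (G M)⁻¹`. -/
def Sig.stub_resistanceQuasiMonotone : Prop :=
  ∀ ω₂ lam β γ : ℝ, 0 < ω₂ → 0 < lam → 0 < β → 0 < γ →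
    (∀ (N : ℕ) (T_L T_R : ℝ), 0 < T_L → 0 < T_R →
      ∀ μ ν : MeasureTheory.Measure (Literature.MathematicalPhysics.KineticTheory.HeatConduction.PhaseSpace N),
        (Literature.MathematicalPhysics.KineticTheory.HeatConduction.pinnedChain ω₂ lam β γ).IsSteadyState N T_L T_R μ →
        (Literature.MathematicalPhysics.KineticTheory.HeatConduction.pinnedChain ω₂ lam β γ).IsSteadyState N T_L T_R ν → μ = ν) →
    ∀ μ : (N : ℕ) → ℝ → ℝ → MeasureTheory.Measure (Literature.MathematicalPhysics.KineticTheory.HeatConduction.PhaseSpace N),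
      (∀ (N : ℕ) (T_L T_R : ℝ), 0 < T_L → 0 < T_R →
        (Literature.MathematicalPhysics.KineticTheory.HeatConduction.pinnedChain ω₂ lam β γ).IsSteadyState N T_L T_R (μ N T_L T_R)) →
    ∀ T : ℝ, 0 < T → ∀ G : ℕ → ℝ,
      (∀ N : ℕ, 2 ≤ N → Filter.Tendsto (fun δ : ℝ =>
        (Literature.MathematicalPhysics.KineticTheory.HeatConduction.pinnedChain ω₂ lam β γ).totalCurrent
          (μ N (T + δ / 2) (T - δ / 2)) / (((N : ℝ) - 1) * δ)) (nhdsWithin 0 {(0 : ℝ)}ᶜ) (nhds (G N))) →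
      ∃ C : ℝ, ∀ N M : ℕ, 2 ≤ N → N ≤ M → 0 < G N → 0 < G M → (G N)⁻¹ - C ≤ (G M)⁻¹

/-- MAZUR CONTENT (no ballistic floor; verbatim `JunctionLocality.NonBallistic`, stmt-9127): along
every response sequence `D`, for every `ε > 0` there are arbitrarily long chains with
`D N ≤ ε (N - 1)`. -/
def Sig.stub_nonBallistic : Prop :=
  ∀ ω₂ lam β γ : ℝ, 0 < ω₂ → 0 < lam → 0 < β → 0 < γ →
    (∀ (N : ℕ) (T_L T_R : ℝ), 0 < T_L → 0 < T_R →
      ∀ μ ν : MeasureTheory.Measure (Literature.MathematicalPhysics.KineticTheory.HeatConduction.PhaseSpace N),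
        (Literature.MathematicalPhysics.KineticTheory.HeatConduction.pinnedChain ω₂ lam β γ).IsSteadyState N T_L T_R μ →
        (Literature.MathematicalPhysics.KineticTheory.HeatConduction.pinnedChain ω₂ lam β γ).IsSteadyState N T_L T_R ν → μ = ν) →
    ∀ μ : (N : ℕ) → ℝ → ℝ → MeasureTheory.Measure (Literature.MathematicalPhysics.KineticTheory.HeatConduction.PhaseSpace N),
      (∀ (N : ℕ) (T_L T_R : ℝ), 0 < T_L → 0 < T_R →
        (Literature.MathematicalPhysics.KineticTheory.HeatConduction.pinnedChain ω₂ lam β γ).IsSteadyState N T_L T_R (μ N T_L T_R)) →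
    ∀ T : ℝ, 0 < T → ∀ D : ℕ → ℝ,
      (∀ N : ℕ, Filter.Tendsto (fun δ : ℝ =>
        (Literature.MathematicalPhysics.KineticTheory.HeatConduction.pinnedChain ω₂ lam β γ).totalCurrent
          (μ N (T + δ / 2) (T - δ / 2)) / δ) (nhdsWithin 0 {(0 : ℝ)}ᶜ) (nhds (D N))) →
      ∀ ε : ℝ, 0 < ε → ∀ N₀ : ℕ, ∃ N : ℕ, N₀ ≤ N ∧ D N ≤ ε * ((N : ℝ) - 1)

/-- In-kernel identity certificate: the second stub IS the shared crux decl
`JunctionLocality.NonBallistic` (stmt-AtomisticToContinuum-9127), token for token. -/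
example : Sig.stub_nonBallistic ↔
    Summit.AtomisticToContinuum.FouriersLaw.Theses.JunctionLocality.NonBallistic :=
  Iff.rfl

/-! ## §2 The registered stubs (the only sorries of this file) -/

/-- **STUB 1 — `stub_resistanceQuasiMonotone`** (junction locality, one-sided; size M–L; open).
For `pinnedChain ω₂ lam β γ` (all `> 0`), under weak-NESS uniqueness, for every steady-state family,
every `T > 0` and every conductance sequence `G` (`N ≥ 2`): there is `C` with
`(G N)⁻¹ - C ≤ (G M)⁻¹` whenever `2 ≤ N ≤ M` and `G N, G M > 0` — the bath-to-bath linear-response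
resistance of the chain never DROPS by more than a contact constant when sites are appended.
Why plausibly true: series law — the `M`-chain is the `N`-chain plus `M − N` more (resistive) sites;
cutting at bond `(N−1, N)` and re-terminating by a bath at the self-consistent temperature changes
the resistance by a bounded contact (Kapitza) term, and the removed tail has positive resistance;
exact monotonicity already holds for the HARMONIC member (`fluxCoeff` decreasing in `N`), and
anharmonic scattering at `T > 0` only adds resistance (numerics: `R_N ≈ 2α + N/κ`, Aoki–Kusnezov).
Engines: reservoir-insertion / Büttiker-probe comparison in the open-chain Kubo formula
`D_N = (N−1) T⁻² ∫₀^∞ ⟨j_b(0) Σ_i j_i(t)⟩ dt` (Kundu–Dhar–Narayan 2009; Rey-Bellet 2003 Rem 4.4);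
Dirichlet–Thomson two-sided variational gluing for `L = A_H + γ S` (Landim–Mariani–Seo 2018).
Why it might fail: a coherent length resonance (Fabry–Pérot type: an added segment improving the
impedance match to the bath) lowering `R` by an amount growing with `N` — a wave effect that
anharmonic dephasing at `T > 0` should cap at the contact resistance, but no N-uniform comparison
of NESS currents of a deterministic anharmonic chain at two lengths is in print.
Leans on: `OscillatorChain.totalCurrent`, `IsSteadyState`, `pinnedChain` (Literature
`FouriersLaw.lean`); cf. items `JunctionLocality.SuperadditiveResistance` (stronger, two-piece),
`ParabolicBathMap.ResistanceQuantum` (stronger, conditional on the crux). -/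
theorem stub_resistanceQuasiMonotone :
    ∀ ω₂ lam β γ : ℝ, 0 < ω₂ → 0 < lam → 0 < β → 0 < γ →
    (∀ (N : ℕ) (T_L T_R : ℝ), 0 < T_L → 0 < T_R →
      ∀ μ ν : MeasureTheory.Measure (Literature.MathematicalPhysics.KineticTheory.HeatConduction.PhaseSpace N),
        (Literature.MathematicalPhysics.KineticTheory.HeatConduction.pinnedChain ω₂ lam β γ).IsSteadyState N T_L T_R μ →
        (Literature.MathematicalPhysics.KineticTheory.HeatConduction.pinnedChain ω₂ lam β γ).IsSteadyState N T_L T_R ν → μ = ν) →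
    ∀ μ : (N : ℕ) → ℝ → ℝ → MeasureTheory.Measure (Literature.MathematicalPhysics.KineticTheory.HeatConduction.PhaseSpace N),
      (∀ (N : ℕ) (T_L T_R : ℝ), 0 < T_L → 0 < T_R →
        (Literature.MathematicalPhysics.KineticTheory.HeatConduction.pinnedChain ω₂ lam β γ).IsSteadyState N T_L T_R (μ N T_L T_R)) →
    ∀ T : ℝ, 0 < T → ∀ G : ℕ → ℝ,
      (∀ N : ℕ, 2 ≤ N → Filter.Tendsto (fun δ : ℝ =>
        (Literature.MathematicalPhysics.KineticTheory.HeatConduction.pinnedChain ω₂ lam β γ).totalCurrent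
          (μ N (T + δ / 2) (T - δ / 2)) / (((N : ℝ) - 1) * δ)) (nhdsWithin 0 {(0 : ℝ)}ᶜ) (nhds (G N))) →
      ∃ C : ℝ, ∀ N M : ℕ, 2 ≤ N → N ≤ M → 0 < G N → 0 < G M → (G N)⁻¹ - C ≤ (G M)⁻¹ := by
  sorry

/-- **STUB 2 — `stub_nonBallistic`** (no ballistic floor; size XL, open-problem class; HARDEST;
verbatim the shared crux `JunctionLocality.NonBallistic`, stmt-AtomisticToContinuum-9127, so any
proof of that item discharges this stub by `exact`). For `pinnedChain ω₂ lam β γ` (all `> 0`), under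
weak-NESS uniqueness, for every steady-state family, `T > 0` and response sequence `D`:
`∀ ε > 0, ∀ N₀, ∃ N ≥ N₀, D N ≤ ε (N − 1)` (`liminf_N G_N ≤ 0`).
Why plausibly true: a ballistic floor `G_N ≥ ε₀` at all large `N` needs a conserved quantity
overlapping the current (Mazur); for `lam, β > 0` the only known local charge is the (even) energy,
whose static overlap with the (odd) current vanishes (`Cruxes/NonBallistic/Disproof.lean`:
`integral_totalCurrent_mul_hamiltonian_eq_zero`); numerically transport is normal (BLR 2000 §10).
Registered lines for 9127: contact-current-forgetting, drude-coboundary-certificates,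
drude-controls-conductance, transit-entropy-pairing (`Cruxes/NonBallistic/Lines/`).
Why it might fail: a hidden quasi-local conserved charge of the quartic pinned chain (none known;
integrability excluded only numerically) ⇒ Drude weight ⇒ ballistic floor — and then `FouriersLaw`
itself is false (`not_fouriersLaw_of_not_nonBallistic`). FALSE at `lam = β = 0`
(`nonBallistic_false_without_anharmonicity`): every proof must use the anharmonicity.
Leans on: `OscillatorChain.totalCurrent`, `IsSteadyState`, `pinnedChain`. -/
theorem stub_nonBallistic :
    ∀ ω₂ lam β γ : ℝ, 0 < ω₂ → 0 < lam → 0 < β → 0 < γ →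
    (∀ (N : ℕ) (T_L T_R : ℝ), 0 < T_L → 0 < T_R →
      ∀ μ ν : MeasureTheory.Measure (Literature.MathematicalPhysics.KineticTheory.HeatConduction.PhaseSpace N),
        (Literature.MathematicalPhysics.KineticTheory.HeatConduction.pinnedChain ω₂ lam β γ).IsSteadyState N T_L T_R μ →
        (Literature.MathematicalPhysics.KineticTheory.HeatConduction.pinnedChain ω₂ lam β γ).IsSteadyState N T_L T_R ν → μ = ν) →
    ∀ μ : (N : ℕ) → ℝ → ℝ → MeasureTheory.Measure (Literature.MathematicalPhysics.KineticTheory.HeatConduction.PhaseSpace N),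
      (∀ (N : ℕ) (T_L T_R : ℝ), 0 < T_L → 0 < T_R →
        (Literature.MathematicalPhysics.KineticTheory.HeatConduction.pinnedChain ω₂ lam β γ).IsSteadyState N T_L T_R (μ N T_L T_R)) →
    ∀ T : ℝ, 0 < T → ∀ D : ℕ → ℝ,
      (∀ N : ℕ, Filter.Tendsto (fun δ : ℝ =>
        (Literature.MathematicalPhysics.KineticTheory.HeatConduction.pinnedChain ω₂ lam β γ).totalCurrent
          (μ N (T + δ / 2) (T - δ / 2)) / δ) (nhdsWithin 0 {(0 : ℝ)}ᶜ) (nhds (D N))) →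
      ∀ ε : ℝ, 0 < ε → ∀ N₀ : ℕ, ∃ N : ℕ, N₀ ≤ N ∧ D N ≤ ε * ((N : ℝ) - 1) := by
  sorry

/-! ## §3 Sorry-free helpers: no bond for `N ≤ 1`; conductance → response bridge -/

/-- For `N ≤ 1` there is no bond `(i, i+1)`, so every bond current is identically `0`. [folklore] -/
theorem bondCurrent_eq_zero_of_le_one (P : OscillatorChain) {N : ℕ} (hN : N ≤ 1) (i : Fin N)
    (x : PhaseSpace N) : P.bondCurrent N i x = 0 := by
  unfold OscillatorChain.bondCurrent
  refine Finset.sum_eq_zero fun j _ => ?_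
  have hj : ¬ (j.val = i.val + 1) := by
    have := j.isLt
    omega
  simp [hj]

/-- For `N ≤ 1` the space-summed current of ANY measure vanishes. [folklore] -/
theorem totalCurrent_eq_zero_of_le_one (P : OscillatorChain) {N : ℕ} (hN : N ≤ 1)
    (μ : MeasureTheory.Measure (PhaseSpace N)) : P.totalCurrent μ = 0 := by
  unfold OscillatorChain.totalCurrent
  refine Finset.sum_eq_zero fun i _ => ?_
  simp [bondCurrent_eq_zero_of_le_one P hN]

/-- **The bridge.** A conductance sequence `G` (`N ≥ 2`, quotient by `(N-1) δ`) yields the response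
sequence `D N := (N-1) G N` (`N ≥ 2`), `D N := 0` (`N ≤ 1`, no bond) for ALL `N`. [folklore] -/
theorem response_of_conductance (P : OscillatorChain)
    (μ : (N : ℕ) → ℝ → ℝ → MeasureTheory.Measure (PhaseSpace N)) (T : ℝ) (G : ℕ → ℝ)
    (hG : ∀ N : ℕ, 2 ≤ N → Tendsto
      (fun δ : ℝ => P.totalCurrent (μ N (T + δ / 2) (T - δ / 2)) / (((N : ℝ) - 1) * δ))
      (nhdsWithin 0 {(0 : ℝ)}ᶜ) (nhds (G N))) :
    ∀ N : ℕ, Tendsto (fun δ : ℝ => P.totalCurrent (μ N (T + δ / 2) (T - δ / 2)) / δ)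
      (nhdsWithin 0 {(0 : ℝ)}ᶜ)
      (nhds ((fun n : ℕ => if 2 ≤ n then ((n : ℝ) - 1) * G n else 0) N)) := by
  intro N
  by_cases hN : 2 ≤ N
  · simp only [if_pos hN]
    have hN1 : ((N : ℝ) - 1) ≠ 0 := by
      have : (2 : ℝ) ≤ N := by exact_mod_cast hN
      linarith
    refine ((hG N hN).const_mul ((N : ℝ) - 1)).congr (fun δ => ?_)
    rw [← mul_div_assoc, mul_div_mul_left _ _ hN1]
  · simp only [if_neg hN]
    have hle : N ≤ 1 := by omega
    simp only [totalCurrent_eq_zero_of_le_one P hle, zero_div]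
    exact tendsto_const_nhds

/-! ## §4 The composition (kernel-checked, no sorry) -/

/-- **THE SKELETON THEOREM.** `Sig.stub_resistanceQuasiMonotone → Sig.stub_nonBallistic → Recurrence`:
move to the response sequence `D_N = (N-1) G_N` (bridge), get `G_N > 0` (`N ≥ 2`) from the LANDED
`positiveConductance_holds` and `liminf G_N = 0` from the non-ballistic stub; then a large resistance
`R_N ≥ 2/ε + |C|` at ONE length propagates to every longer chain by quasi-monotonicity
(`R_M ≥ R_N - C ≥ 2/ε`), i.e. `0 < G_M ≤ ε/2` eventually. -/
theorem Recurrence_of :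
    Sig.stub_resistanceQuasiMonotone → Sig.stub_nonBallistic →
      Summit.AtomisticToContinuum.FouriersLaw.Theses.ParabolicBathMap.Recurrence := by
  intro hQM hNB ω₂ lam β γ hω hl hβ hγ hU μ hμ T hT G hG
  -- the response sequence attached to the conductance sequence
  have hD := response_of_conductance (pinnedChain ω₂ lam β γ) μ T G hG
  -- positivity of the conductance for N ≥ 2 (landed fixed-N theorem, D-form)
  have hpos : ∀ N : ℕ, 2 ≤ N → 0 < G N := by
    intro N hN
    have h := _root_.Summit.AtomisticToContinuum.FouriersLaw.Cruxes.BoundedResponseConverges.TwoScaleGluingLogRigidity.Stubs.positiveConductance_holds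
      ω₂ lam β γ hω hl hβ hγ hU μ hμ T hT (fun n : ℕ => if 2 ≤ n then ((n : ℝ) - 1) * G n else 0) hD N hN
    have h' : 0 < ((N : ℝ) - 1) * G N := by simpa [if_pos hN] using h
    have h2 : (0 : ℝ) < (N : ℝ) - 1 := by
      have : (2 : ℝ) ≤ N := by exact_mod_cast hN
      linarith
    exact (mul_pos_iff_of_pos_left h2).mp h'
  -- the non-ballistic stub, moved to conductance form: small conductances at arbitrarily long chains
  have hnb : ∀ ε : ℝ, 0 < ε → ∃ N : ℕ, 2 ≤ N ∧ G N ≤ ε := by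
    intro ε hε
    obtain ⟨N, hN, hDN⟩ := hNB ω₂ lam β γ hω hl hβ hγ hU μ hμ T hT
      (fun n : ℕ => if 2 ≤ n then ((n : ℝ) - 1) * G n else 0) hD ε hε 2
    refine ⟨N, hN, ?_⟩
    have h' : ((N : ℝ) - 1) * G N ≤ ε * ((N : ℝ) - 1) := by simpa [if_pos hN] using hDN
    have h2 : (0 : ℝ) < (N : ℝ) - 1 := by
      have : (2 : ℝ) ≤ N := by exact_mod_cast hN
      linarith
    rw [mul_comm] at h'
    exact le_of_mul_le_mul_right h' h2
  -- quasi-monotonicity of the resistance along this conductance sequence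
  obtain ⟨C, hC⟩ := hQM ω₂ lam β γ hω hl hβ hγ hU μ hμ T hT G hG
  rw [Metric.tendsto_atTop]
  intro ε hε
  have hKpos : (0 : ℝ) < 2 / ε + |C| := by positivity
  obtain ⟨N, hN2, hGN⟩ := hnb (2 / ε + |C|)⁻¹ (inv_pos.mpr hKpos)
  refine ⟨N, fun M hM => ?_⟩
  have hGNpos : 0 < G N := hpos N hN2
  have hGMpos : 0 < G M := hpos M (le_trans hN2 hM)
  have h1 : (G N)⁻¹ - C ≤ (G M)⁻¹ := hC N M hN2 hM hGNpos hGMpos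
  have h2 : 2 / ε + |C| ≤ (G N)⁻¹ := (le_inv_comm₀ hKpos hGNpos).mpr hGN
  have h3 : 2 / ε ≤ (G M)⁻¹ := by
    have : C ≤ |C| := le_abs_self C
    linarith
  have h2ε : (0 : ℝ) < 2 / ε := by positivity
  have h4 : G M ≤ (2 / ε)⁻¹ := (le_inv_comm₀ h2ε hGMpos).mp h3
  rw [inv_div] at h4
  rw [Real.dist_eq, sub_zero, abs_of_pos hGMpos]
  linarith

/-- The skeleton instantiated through the sorried stubs (an `example`: registers nothing, leaves
`Recurrence_of` the unique crux-concluding declaration). -/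
example : Summit.AtomisticToContinuum.FouriersLaw.Theses.ParabolicBathMap.Recurrence :=
  Recurrence_of stub_resistanceQuasiMonotone stub_nonBallistic

end Summit.AtomisticToContinuum.FouriersLaw.Cruxes.Recurrence.Birth
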